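import Summits.QuantumFields.GaugeBoot.FrickeTracePolynomial
import Summits.QuantumFields.GaugeBoot.SU2LoopPairInversion
import Literature.MathematicalPhysics.QuantumLattice.NarrowWellPlaquetteAction
import HarnessLib

/-!
# `SU(2)`: every loop variable generated by two loops is a polynomial in THREE of them
# (gauge-boot, large-`N` supplement 17, part 8 — Fricke coordinates of composite loops)

HONEST FRAMING (cell `pub-gaugeboot`, page 1 of every file): the venture produces certified bounds
on lattice expectations at stated coupling, gauge group, dimension and torus size; NOT a mass gap,
NOT a continuum limit, NOT a string tension; NOT large `N` unless marked CONDITIONAL; NOT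
Yang–Mills-summit-bearing (barriers `FixedCouplingUltralocality`, `PerturbativeInvisibility`).
Parts 2 and 7 combined; this file certifies no number.

## Content

For `SU(2)` (inverse = conjugate transpose = adjugate) the holonomy of a composite loop `w(p,q)`
(`Word.subst`, part 2) is the `SL(2)` word value of part 7 (`coe_prod_eq_wordVal`,
`coe_wordHolonomy_subst_eq_wordVal`), so Fricke–Klein applies POINTWISE in the configuration:

* ★★ `trace_wordHolonomy_subst_eq_fricke` — `tr hol_x(w(p,q)) = 2x₀ + tr(h_p)x₁ + tr(h_q)x₂ + tr(h_p h_q)x₃`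
  with `x = frickeCoeffs (tr h_p) (tr h_q) (tr h_p h_q) w`: **every `SU(2)` loop variable in the two loops
  `p, q` is an explicit integer polynomial in the three numbers `W(p), W(q), W(pq)` of the same
  configuration** (the traces are real: `trace_coe_su2_eq_ofReal`);
* ★★★ `wordLoop_subst_eq_of_three_eq` — two pairs of loops `(p,q)` at `x` and `(p',q')` at `x'`
  (possibly on different sites) whose THREE loop variables `W(p), W(q), W(pq)` agree at a configuration
  have ALL composite loop variables `W(w(p,q)) = W(w(p',q'))` equal at that configuration, for every
  word `w`.

For the bootstrap these are polynomial (not linear) pointwise relations; in expectation they do not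
close, but they exhibit the redundancy of loop-indexed variable lists for `SU(2)`: modulo the three
"Fricke coordinates" nothing generated by two loops is new.  [folklore] (Fricke–Klein; Horowitz 1972.)
-/

noncomputable section

open Literature.MathematicalPhysics.QuantumFieldTheory
open Literature.MathematicalPhysics.QuantumLattice (quatMatrix star_coe_eq_adjugate fundamentalRep_apply)

namespace Summit.QuantumFields.GaugeBoot

namespace Fricke

variable {d L : ℕ}

/-- In `SU(2)` the inverse is the adjugate (as a matrix). [folklore] -/
theorem coe_inv_eq_adjugate (g : SU 2) : ((g⁻¹ : SU 2) : Matrix (Fin 2) (Fin 2) ℂ) = (g : Matrix (Fin 2) (Fin 2) ℂ).adjugate := by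
  rw [← star_coe_eq_adjugate]
  rfl

/-- The trace of an `SU(2)` matrix is real. [folklore] -/
theorem trace_coe_su2_eq_ofReal (g : SU 2) :
    (g : Matrix (Fin 2) (Fin 2) ℂ).trace = (((g : Matrix (Fin 2) (Fin 2) ℂ).trace.re : ℝ) : ℂ) := by
  apply Complex.ext
  · simp
  · simp [Literature.MathematicalPhysics.QuantumLattice.NarrowWell.trace_im_eq_zero g]

/-- **The `SU(2)` product over a letter list is the `SL(2)` word value of part 7.** [folklore] -/
theorem coe_prod_eq_wordVal (g : Fin 2 → SU 2) : ∀ ℓ : List (Fin 2 × Bool),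
    (((ℓ.map fun y => cond y.2 (g y.1) (g y.1)⁻¹).prod : SU 2) : Matrix (Fin 2) (Fin 2) ℂ) =
      wordVal (g 0 : Matrix (Fin 2) (Fin 2) ℂ) (g 1 : Matrix (Fin 2) (Fin 2) ℂ) ℓ
  | [] => by simp [wordVal]
  | y :: ℓ => by
    rw [List.map_cons, List.prod_cons, wordVal, List.map_cons, List.prod_cons, ← wordVal, ← coe_prod_eq_wordVal g ℓ]
    show ((cond y.2 (g y.1) (g y.1)⁻¹ : SU 2) : Matrix (Fin 2) (Fin 2) ℂ) * _ = _
    congr 1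
    obtain ⟨i, s⟩ := y
    fin_cases i <;> cases s <;> simp [lval, coe_inv_eq_adjugate]

/-- The holonomy of a composite loop `w(P 0, P 1)` over `SU(2)` is the word value at the two loop
holonomies (torus). [folklore] -/
theorem coe_wordHolonomy_subst_eq_wordVal (U : GaugeConfig d L (SU 2)) (x : Site d L) (P : Fin 2 → Word d)
    (hP : ∀ i, Word.endpoint x (P i) = x) (ℓ : List (Fin 2 × Bool)) :
    ((wordHolonomy U x (Word.subst P ℓ) : SU 2) : Matrix (Fin 2) (Fin 2) ℂ) =
      wordVal ((wordHolonomy U x (P 0) : SU 2) : Matrix (Fin 2) (Fin 2) ℂ) (wordHolonomy U x (P 1) : SU 2) ℓ := by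
  rw [wordHolonomy_subst U x P hP ℓ]
  exact coe_prod_eq_wordVal (fun i => wordHolonomy U x (P i)) ℓ

/-- ★★ **Fricke coordinates** (torus): `tr hol_x(w(p,q)) = 2x₀ + tr(h_p) x₁ + tr(h_q) x₂ + tr(h_p h_q) x₃`,
`x = frickeCoeffs (tr h_p) (tr h_q) (tr h_p h_q) w`, pointwise in the configuration. [folklore] -/
theorem trace_wordHolonomy_subst_eq_fricke (U : GaugeConfig d L (SU 2)) (x : Site d L) (P : Fin 2 → Word d)
    (hP : ∀ i, Word.endpoint x (P i) = x) (ℓ : List (Fin 2 × Bool)) :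
    let hp : Matrix (Fin 2) (Fin 2) ℂ := (wordHolonomy U x (P 0) : SU 2)
    let hq : Matrix (Fin 2) (Fin 2) ℂ := (wordHolonomy U x (P 1) : SU 2)
    ((wordHolonomy U x (Word.subst P ℓ) : SU 2) : Matrix (Fin 2) (Fin 2) ℂ).trace =
      2 * frickeCoeffs hp.trace hq.trace (hp * hq).trace ℓ 0 + hp.trace * frickeCoeffs hp.trace hq.trace (hp * hq).trace ℓ 1
        + hq.trace * frickeCoeffs hp.trace hq.trace (hp * hq).trace ℓ 2
        + (hp * hq).trace * frickeCoeffs hp.trace hq.trace (hp * hq).trace ℓ 3 := by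
  intro hp hq
  rw [coe_wordHolonomy_subst_eq_wordVal U x P hP ℓ]
  exact trace_wordVal_eq (Matrix.mem_specialUnitaryGroup_iff.1 (wordHolonomy U x (P 0)).2).2
    (Matrix.mem_specialUnitaryGroup_iff.1 (wordHolonomy U x (P 1)).2).2 ℓ

/-- `tr (h_p h_q) = tr hol_x(p·q)` (the product loop). [folklore] -/
theorem coe_wordHolonomy_append_closed (U : GaugeConfig d L (SU 2)) (x : Site d L) {p q : Word d}
    (hp : Word.endpoint x p = x) :
    ((wordHolonomy U x (p ++ q) : SU 2) : Matrix (Fin 2) (Fin 2) ℂ) =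
      ((wordHolonomy U x p : SU 2) : Matrix (Fin 2) (Fin 2) ℂ) * (wordHolonomy U x q : SU 2) := by
  rw [wordHolonomy_append, hp]
  rfl

/-- ★★★ **Three loop variables determine all**: if two pairs of loops `(P 0, P 1)` at `x` and
`(P' 0, P' 1)` at `x'` have the same `SU(2)` loop variables `W(p) = W(p')`, `W(q) = W(q')`,
`W(p q) = W(p' q')` at the configurations `U`, `U'`, then `W_x(w(p,q))(U) = W_{x'}(w(p',q'))(U')` for
EVERY word `w`. [folklore] -/
theorem wordLoop_subst_eq_of_three_eq {d' L' : ℕ} (U : GaugeConfig d L (SU 2)) (U' : GaugeConfig d' L' (SU 2))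
    (x : Site d L) (x' : Site d' L') (P : Fin 2 → Word d) (P' : Fin 2 → Word d')
    (hP : ∀ i, Word.endpoint x (P i) = x) (hP' : ∀ i, Word.endpoint x' (P' i) = x')
    (h0 : wordLoop (suRep 2) x (P 0) U = wordLoop (suRep 2) x' (P' 0) U')
    (h1 : wordLoop (suRep 2) x (P 1) U = wordLoop (suRep 2) x' (P' 1) U')
    (h01 : wordLoop (suRep 2) x (P 0 ++ P 1) U = wordLoop (suRep 2) x' (P' 0 ++ P' 1) U') (ℓ : List (Fin 2 × Bool)) :
    wordLoop (suRep 2) x (Word.subst P ℓ) U = wordLoop (suRep 2) x' (Word.subst P' ℓ) U' := by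
  -- real loop variables `(1/2) Re tr` with real traces determine the complex traces
  have key : ∀ (g g' : SU 2), (2 : ℝ)⁻¹ * ((suRep 2 g).trace).re = (2 : ℝ)⁻¹ * ((suRep 2 g').trace).re →
      (g : Matrix (Fin 2) (Fin 2) ℂ).trace = (g' : Matrix (Fin 2) (Fin 2) ℂ).trace := by
    intro g g' h
    rw [fundamentalRep_apply, fundamentalRep_apply] at h
    have h' : ((g : Matrix (Fin 2) (Fin 2) ℂ).trace).re = ((g' : Matrix (Fin 2) (Fin 2) ℂ).trace).re := by
      have := mul_left_cancel₀ (by norm_num : (2 : ℝ)⁻¹ ≠ 0) h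
      exact this
    rw [trace_coe_su2_eq_ofReal g, trace_coe_su2_eq_ofReal g', h']
  simp only [wordLoop_apply, Nat.cast_ofNat] at h0 h1 h01 ⊢
  have t0 := key _ _ h0
  have t1 := key _ _ h1
  have t01 := key _ _ h01
  rw [coe_wordHolonomy_append_closed U x (hP 0), coe_wordHolonomy_append_closed U' x' (hP' 0)] at t01
  rw [fundamentalRep_apply, fundamentalRep_apply, coe_wordHolonomy_subst_eq_wordVal U x P hP,
    coe_wordHolonomy_subst_eq_wordVal U' x' P' hP',
    trace_wordVal_eq_of_traces_eq (Matrix.mem_specialUnitaryGroup_iff.1 (wordHolonomy U x (P 0)).2).2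
      (Matrix.mem_specialUnitaryGroup_iff.1 (wordHolonomy U x (P 1)).2).2
      (Matrix.mem_specialUnitaryGroup_iff.1 (wordHolonomy U' x' (P' 0)).2).2
      (Matrix.mem_specialUnitaryGroup_iff.1 (wordHolonomy U' x' (P' 1)).2).2 t0.symm t1.symm t01.symm ℓ]

end Fricke

end Summit.QuantumFields.GaugeBoot

end
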